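import Literature.AnabelianGeometry.SemiGraphs.Temperoids
import HarnessLib

/-!
# Semi-graphs of anabelioids, §3: endomorphisms of Galois objects (proof of Remark 3.1.6, first claim)

Mochizuki, *Semi-graphs of anabelioids*, Publ. RIMS **42** (2006), §3, Remark 3.1.6 (manuscript
p. 34) [cite: MochizukiSemiAnbd2006, Rmk 3.1.6 p.34]: "it is immediate from the definitions that every
endomorphism of a Galois connected object of a temperoid is an automorphism."  PROOF-ONLY companion
of `Temperoids.lean` (abc-iut-L3-t2): the named fact `EndOfGaloisIsIso` is DISCHARGED
(`EndOfGaloisIsIso_holds`); no new definition.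

Proof (it is indeed immediate from Definition 3.1 (iv), and uses neither temperedness nor anything
about `B^temp(Π)`): for a Galois object `T` and an endomorphism `f`, apply the Galois property to the
two arrows `𝟙_T, f : T → T` (`T` is connected): there is an automorphism `α` with `𝟙 = f ≫ α`, so
`f = α⁻¹` is an isomorphism.  Nothing here takes a side on [IUTchIII] Cor. 3.12.
-/

namespace Literature.AnabelianGeometry.SemiGraphs

open CategoryTheory

universe u

/-- In ANY category: an endomorphism of an object that is Galois in the sense of [SemiAnbd]
Def. 3.1 (iv) (`IsGaloisObj`) is an isomorphism — the Galois property applied to `𝟙` and `f`.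
[cite: MochizukiSemiAnbd2006, Rmk 3.1.6 p.34] -/
theorem IsGaloisObj.isIso_of_endo {C : Type*} [Category C] {T : C} (hT : IsGaloisObj T)
    (f : T ⟶ T) : IsIso f := by
  obtain ⟨α, hα⟩ := hT.2 T hT.1 (𝟙 T) f
  exact isIso_of_comp_hom_eq_id α.hom hα.symm

/-- **[SemiAnbd] Remark 3.1.6** (p. 34) — DISCHARGE of the named fact `EndOfGaloisIsIso` of
`Temperoids.lean`: "every endomorphism of a Galois connected object of a temperoid is an
automorphism" (for `B^temp(Π)`). [cite: MochizukiSemiAnbd2006, Rmk 3.1.6 p.34] -/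
theorem EndOfGaloisIsIso_holds (G : Type u) [Group G] [TopologicalSpace G] [IsTopologicalGroup G] :
    EndOfGaloisIsIso G :=
  fun _ _ hT f => hT.isIso_of_endo f

end Literature.AnabelianGeometry.SemiGraphs
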